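import Literature.MathematicalPhysics.QuantumLattice.DWaveOrderParameterProofs
import Literature.MathematicalPhysics.QuantumLattice.PairCorrelationsProofs
import Literature.MathematicalPhysics.QuantumLattice.LatticeToriLROProofs
import Literature.MathematicalPhysics.QuantumLattice.PairFieldMomentum
import Literature.MathematicalPhysics.QuantumLattice.HubbardModelGrandCanonicalProofs
import Summits.HubbardSuperconductivity.HubbardSuperconductivity.Theorems.WeakCouplingBCSWcbcsBcsConstructionOrderFloorOfSeeds

/-!
# Stub `stub_subsequenceOrderForcesSSB` (D1) of line `birth`
# (crux `BridgeNodalToDWave`, item stmt-HubbardSuperconductivity-10395, route NodalDiracTwist)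

**The Koma–Tasaki forward leg for the `d`-wave pair field, along a subsequence of sides.**
Fix `U > 0`, a doping `δ`, a chemical potential `μ`, and a family `ψ L` of normalised
`(N_L, S^z = 0)`-sector ground states of the canonical torus Hubbard Hamiltonian
`hubbardTorus 2 L 1 U` (`N_L = 2⌊(1-δ)L²/2⌋` at every even side `L`). Assume

* (TL) for every source strength `h ≥ 0` the sourced grand-canonical ground-state energy density
  `E₀(dWaveSourceTorus (L+1) U μ h)/(L+1)²` converges as `L → ∞`;
* (EM) energy matching at `μ`:
  `(E_sec(L+1) - μ N_{L+1} - E₀(hubbardTorusWith 2 (L+1) 1 U μ))/(L+1)² → 0`,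
  `E_sec` the `(N, S^z = 0)`-sector ground energy of `hubbardTorus 2 (L+1) 1 U`;
* (ORDER) the `d`-wave pair order
  `F_ψ(k) = |Λ_{2k}|⁻² Σ_{x,y ∈ Λ_{2k}} Re⟨ψ_{2k}, P_x† P_y ψ_{2k}⟩` is `≥ c > 0` for INFINITELY
  MANY `k`.

Then `HasDWaveOrder U μ`, i.e. the Koma–Tasaki `d`-wave order parameter
`liminf_{h→0⁺} liminf_L Re ω₀^{L+1,h}(Δ_d)/(L+1)²` is strictly positive (in fact `≥ √c/2`).

## Proof outline

Everything is assembled from landed tree facts.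

1. At an ordered side `L = 2k` the vector `Φ = ψ L` is a unit `N_L`-particle vector with
   `(H(1,U) - μN)Φ = (E_sec - μN_L)Φ`, so its grand-canonical energy excess is exactly the (EM)
   numerator, and `Re⟨Φ, O²Φ⟩ ≥ Re⟨Φ, Δ_d†Δ_d Φ⟩ ≥ cL⁴` for the order operator `O = Δ_d + Δ_d†`
   (the charge-`∓4` words `Δ_d²`, `Δ_d†²` have no diagonal matrix element in a number eigenstate —
   selection rules of `WcbcsTrialState`). The landed Koma–Tasaki trial-state bound
   `stub_trialStateBound` (fed with `stub_hamiltonianNormBound`, `stub_doubleCommutatorBound`)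
   and the kink algebra `wcbcs_kink_algebra` then give, at every `h > 0`,
   `√c/2 - r_L ≤ (E₀(L,0) - E₀(L,h))/(2hL²)` with `r_L = x_L/(4h) + C√x_L + C'/L⁴`, `x_L` the (EM)
   sequence (`exists_kinkBound`).
2. Fix `h ∈ (0,1)`. By (TL) at `0` and at `h` the gain sequence
   `g_L = (E₀(L+1,0) - E₀(L+1,h))/(2h(L+1)²)` CONVERGES, so its `liminf` is its limit; by step 1
   and (ORDER) `√c/2 - r_L ≤ g_L` frequently, and
   `r_L → 0` (`wcbcs_remainder_tendsto`), hence `√c/2 ≤ lim g = liminf g`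
   (`le_of_tendsto_of_tendsto_of_frequently`).
3. `le_dWaveOrderParameter_of_le_liminf_energyGain` turns the linear energy gain into the floor
   `√c/2 ≤ dWaveOrderParameter U μ`, whence `HasDWaveOrder U μ`.

Sources: T. Koma, H. Tasaki, *Symmetry breaking and finite-size effects in quantum many-body
systems*, J. Stat. Phys. 76 (1994) 745, Theorem 2.3 and Remark 2 (order along a sequence of volumes
forces symmetry breaking under an infinitesimal field; proof of Theorem 2.2 for the trial state);
T. A. Kaplan, P. Horsch, W. von der Linden, J. Phys. Soc. Jpn. 58 (1989) 3894 (LRO versus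
symmetry breaking in finite systems). No new definitions; no named facts beyond landed theorems.
Supports the crux (`--supports stmt-HubbardSuperconductivity-10395`).
-/

-- the mandated namespace repeats `HubbardSuperconductivity` (single-problem summit, D-0017),
-- which the `dupNamespace` linter flags on every declaration
set_option linter.dupNamespace false

namespace Summit.HubbardSuperconductivity.HubbardSuperconductivity.Theorems.NodalDiracTwist.BridgeNodalToDWave

open Filter Matrix Literature.MathematicalPhysics.QuantumLattice
open Literature.Probability.LatticeModels
open scoped ComplexOrder Topology

/-- **Selection rule for the pair order.** For an `n`-particle torus vector `Φ` and the `d`-wave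
pair field `Δ_d`, `Re⟨Φ, Δ_d†Δ_d Φ⟩ ≤ Re⟨Φ, O²Φ⟩` with `O = Δ_d + Δ_d†`: expanding `O²`, the
charge-`∓4` words `Δ_d²`, `(Δ_d†)²` have vanishing diagonal matrix elements in a particle-number
eigenstate (`[N, Δ_d] = -2Δ_d`), and `⟨Φ, Δ_dΔ_d†Φ⟩ = ‖Δ_d†Φ‖² ≥ 0`. [folklore] -/
theorem re_expect_conjTranspose_mul_le_re_expect_sq {L n : ℕ} [NeZero L]
    {Φ : Fock (Orb (FermionTorus 2 L))} (hΦ : IsNParticle n Φ) :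
    (expect ((pairField dWaveFormFactor L)ᴴ * pairField dWaveFormFactor L) Φ).re ≤
      (expect ((pairField dWaveFormFactor L + (pairField dWaveFormFactor L)ᴴ) *
        (pairField dWaveFormFactor L + (pairField dWaveFormFactor L)ᴴ)) Φ).re := by
  set Δ := pairField dWaveFormFactor L with hΔ_def
  have hNh : (totalNumber : Matrix (Finset (Orb (FermionTorus 2 L))) _ ℂ).IsHermitian :=
    totalNumber_isHermitian
  have hNΦ := WcbcsTrialState.totalNumber_mulVec_of_isNParticle hΦ
  have hNΔ : totalNumber * Δ - Δ * totalNumber = ((-2 : ℝ) : ℂ) • Δ :=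
    WcbcsTrialState.totalNumber_commutator_pairField_dWave L
  have hNΔ' := WcbcsTrialState.commutator_conjTranspose_of_commutator hNh hNΔ
  -- the charges of `Δ Φ`, `Δ² Φ`, `Δᴴ Φ`, `Δᴴ² Φ`
  have hm := WcbcsTrialState.eigen_mulVec_of_commutator hNΔ hNΦ
  have hmm := WcbcsTrialState.eigen_mulVec_of_commutator hNΔ hm
  have hp := WcbcsTrialState.eigen_mulVec_of_commutator hNΔ' hNΦ
  have hpp := WcbcsTrialState.eigen_mulVec_of_commutator hNΔ' hp
  have h1 : star Φ ⬝ᵥ (Δ *ᵥ (Δ *ᵥ Φ)) = 0 :=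
    WcbcsTrialState.star_dotProduct_eq_zero_of_eigen hNh hNΦ hmm (by intro h; linarith)
  have h2 : star Φ ⬝ᵥ (Δᴴ *ᵥ (Δᴴ *ᵥ Φ)) = 0 :=
    WcbcsTrialState.star_dotProduct_eq_zero_of_eigen hNh hNΦ hpp (by intro h; linarith)
  have h3 : 0 ≤ (star Φ ⬝ᵥ (Δ *ᵥ (Δᴴ *ᵥ Φ))).re := by
    have : star Φ ⬝ᵥ (Δ *ᵥ (Δᴴ *ᵥ Φ)) = star (Δᴴ *ᵥ Φ) ⬝ᵥ (Δᴴ *ᵥ Φ) := by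
      rw [star_mulVec, conjTranspose_conjTranspose, ← dotProduct_mulVec]
    rw [this]
    exact (Complex.nonneg_iff.1 (dotProduct_star_self_nonneg _)).1
  have e1 : expect (Δ * Δ) Φ = 0 := by rw [expect, ← mulVec_mulVec]; exact h1
  have e2 : expect (Δᴴ * Δᴴ) Φ = 0 := by rw [expect, ← mulVec_mulVec]; exact h2
  have e3 : 0 ≤ (expect (Δ * Δᴴ) Φ).re := by rw [expect, ← mulVec_mulVec]; exact h3
  rw [add_mul, mul_add, mul_add, expect_add, expect_add, expect_add, e1, e2, zero_add, add_zero,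
    Complex.add_re]
  linarith

/-- **Pointwise Koma–Tasaki kink bound at an ordered side.** There is `B > 0` (the constant of the
landed trial-state bound `stub_trialStateBound` fed with `stub_hamiltonianNormBound` and
`stub_doubleCommutatorBound`) such that on every torus `(ℤ/Lℤ)²`, for `U ≥ 0`, `h > 0`, `c > 0`,
every normalised `(n, S^z = 0)`-sector ground state `Φ` of `hubbardTorus 2 L 1 U` with `d`-wave
pair order
`Re⟨Φ, Δ_d†Δ_d Φ⟩ ≥ cL⁴` forces the linear energy gain
`√c/2 - x/(4h) - B(1+U+|μ|)√x/(4h·√c/2) - B(1+U+|μ|)/(8h(√c/2)²L⁴) ≤ (E₀(L,0) - E₀(L,h))/(2hL²)`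
of the sourced Hamiltonian `dWaveSourceTorus L U μ ·`, where `x = (E_sec - μn - E₀(H(1,U) - μN))/L²`
is the grand-canonical energy excess density of `Φ` (`(H(1,U) - μN)Φ = (E_sec - μn)Φ`): the trial
state `Φ + OΦ/‖OΦ‖`, `O = Δ_d + Δ_d†`, at `s = √c·L² ≤ ‖OΦ‖`. [cite: KomaTasaki1994, Theorem 2.3] -/
theorem exists_kinkBound :
    ∃ B : ℝ, 0 < B ∧ ∀ (L : ℕ) [NeZero L] (U μ h c : ℝ), 0 ≤ U → 0 < h → 0 < c →
      ∀ (n : ℕ) (Φ : Fock (Orb (FermionTorus 2 L))), star Φ ⬝ᵥ Φ = 1 →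
      IsGroundStateInSector (hubbardTorus 2 L 1 U) n 0 Φ →
      c * (L : ℝ) ^ 4 ≤
        (expect ((pairField dWaveFormFactor L)ᴴ * pairField dWaveFormFactor L) Φ).re →
      Real.sqrt c / 2 -
            ((hubbardTorus 2 L 1 U).minEnergyOn (szSector n 0) - μ * n -
                (hubbardTorusWith 2 L 1 U μ).groundEnergy) / (L : ℝ) ^ 2 / (4 * h) -
          B * (1 + U + |μ|) / (4 * h * (Real.sqrt c / 2)) *
            Real.sqrt (((hubbardTorus 2 L 1 U).minEnergyOn (szSector n 0) - μ * n -
                (hubbardTorusWith 2 L 1 U μ).groundEnergy) / (L : ℝ) ^ 2) -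
          B * (1 + U + |μ|) / (8 * h * (Real.sqrt c / 2) ^ 2) / (L : ℝ) ^ 4 ≤
        ((dWaveSourceTorus L U μ 0).groundEnergy - (dWaveSourceTorus L U μ h).groundEnergy) /
          (2 * h * (L : ℝ) ^ 2) := by
  obtain ⟨B, hB, htrial⟩ :=
    stub_trialStateBound stub_hamiltonianNormBound stub_doubleCommutatorBound
  refine ⟨B, hB, fun L _ U μ h c hU hh hc n Φ hnorm hgs hord => ?_⟩
  obtain ⟨hmem, -, heig⟩ := hgs
  have hN : IsNParticle n Φ := ((mem_szSector_iff n 0 Φ).1 hmem).1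
  have hLr : (0 : ℝ) < (L : ℝ) := by exact_mod_cast Nat.pos_of_ne_zero (NeZero.ne L)
  have hε : 0 < Real.sqrt c / 2 := half_pos (Real.sqrt_pos.2 hc)
  have hs : (0 : ℝ) < 2 * (Real.sqrt c / 2) * (L : ℝ) ^ 2 := by positivity
  -- `s² = cL⁴ ≤ Re⟨Φ, Δ†Δ Φ⟩ ≤ Re⟨Φ, O²Φ⟩`
  have hsq : (2 * (Real.sqrt c / 2) * (L : ℝ) ^ 2) ^ 2 ≤
      (expect ((pairField dWaveFormFactor L + (pairField dWaveFormFactor L)ᴴ) *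
        (pairField dWaveFormFactor L + (pairField dWaveFormFactor L)ᴴ)) Φ).re := by
    have h1 : (2 * (Real.sqrt c / 2) * (L : ℝ) ^ 2) ^ 2 = c * (L : ℝ) ^ 4 := by
      rw [show 2 * (Real.sqrt c / 2) = Real.sqrt c by ring, mul_pow, Real.sq_sqrt hc.le]
      ring
    rw [h1]
    exact hord.trans (re_expect_conjTranspose_mul_le_re_expect_sq hN)
  have key := htrial L U μ h (2 * (Real.sqrt c / 2) * (L : ℝ) ^ 2) hU hh.le hs Φ n hnorm hN hsq
  -- the grand-canonical energy of `Φ` is `E_sec - μ n`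
  have hNΦ := WcbcsTrialState.totalNumber_mulVec_of_isNParticle hN
  have hHΦ : hubbardTorusWith 2 L 1 U μ *ᵥ Φ =
      ((((hubbardTorus 2 L 1 U).minEnergyOn (szSector n 0) - μ * n : ℝ)) : ℂ) • Φ := by
    rw [hubbardTorusWith_eq, sub_mulVec, smul_mulVec, heig, hNΦ, smul_smul, ← sub_smul,
      Complex.ofReal_sub, Complex.ofReal_mul]
  have hexpect : (expect (hubbardTorusWith 2 L 1 U μ) Φ).re =
      (hubbardTorus 2 L 1 U).minEnergyOn (szSector n 0) - μ * n := by
    rw [expect, hHΦ, dotProduct_smul, hnorm, smul_eq_mul, mul_one, Complex.ofReal_re]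
  rw [hexpect] at key
  -- excess `e = x · L²`, then the kink algebra
  set x : ℝ := ((hubbardTorus 2 L 1 U).minEnergyOn (szSector n 0) - μ * n -
      (hubbardTorusWith 2 L 1 U μ).groundEnergy) / (L : ℝ) ^ 2 with hx_def
  have hxe : (hubbardTorus 2 L 1 U).minEnergyOn (szSector n 0) - μ * n -
      (hubbardTorusWith 2 L 1 U μ).groundEnergy = x * (L : ℝ) ^ 2 := by
    simp only [hx_def]
    field_simp
  rw [hxe] at key
  rw [dWaveSourceTorus_zero]
  have := wcbcs_kink_algebra (B := B) (K := 1 + U + |μ|) hε hh hLr key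
  have hrw : B * (1 + U + |μ|) / (8 * h * (Real.sqrt c / 2) ^ 2 * (L : ℝ) ^ 4) =
      B * (1 + U + |μ|) / (8 * h * (Real.sqrt c / 2) ^ 2) / (L : ℝ) ^ 4 := by rw [div_div]
  rw [hrw] at this
  exact this

/-- **Stub D1 — `SubsequenceOrderForcesSSB`** (Koma–Tasaki forward leg, `d`-wave pair field).
At `U > 0` and a chemical potential `μ` with energy matching (EM), given the sourced thermodynamic
limit (TL), `d`-wave pair order `≥ c > 0` of an admissible family of `(N_L, S^z = 0)`-sector ground
states along INFINITELY MANY even sides `2k` forces Koma–Tasaki `d`-wave order `HasDWaveOrder U μ`: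
at each ordered side the kink bound `exists_kinkBound` gives the linear energy gain
`(E₀(L,0) - E₀(L,h))/(2hL²) ≥ √c/2 - o(1)` (the `o(1)` by (EM) and `wcbcs_remainder_tendsto`); by
(TL) the gain sequence converges, so its `liminf` equals its limit, which is `≥ √c/2` because the
bound holds frequently (`le_of_tendsto_of_tendsto_of_frequently`); and
`le_dWaveOrderParameter_of_le_liminf_energyGain` converts the gain into
`√c/2 ≤ dWaveOrderParameter U μ`. [cite: KomaTasaki1994, Theorem 2.3] -/
theorem stub_subsequenceOrderForcesSSB : ∀ (U δ μ : ℝ), 0 < U → δ ∈ Set.Icc (1 / 10 : ℝ) (3 / 10) →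
    (∀ h : ℝ, 0 ≤ h → ∃ e : ℝ, Filter.Tendsto (fun L : ℕ =>
      (Literature.MathematicalPhysics.QuantumLattice.dWaveSourceTorus (L + 1) U μ h).groundEnergy /
        ((L + 1 : ℕ) : ℝ) ^ 2) Filter.atTop (nhds e)) →
    Filter.Tendsto (fun L : ℕ =>
      ((Literature.MathematicalPhysics.QuantumLattice.hubbardTorus 2 (L + 1) 1 U).minEnergyOn
          (Literature.MathematicalPhysics.QuantumLattice.szSector
            (2 * ⌊(1 - δ) * ((L + 1 : ℕ) : ℝ) ^ 2 / 2⌋₊) 0) -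
        μ * ((2 * ⌊(1 - δ) * ((L + 1 : ℕ) : ℝ) ^ 2 / 2⌋₊ : ℕ) : ℝ) -
        (Literature.MathematicalPhysics.QuantumLattice.hubbardTorusWith 2 (L + 1) 1 U μ).groundEnergy) /
        ((L + 1 : ℕ) : ℝ) ^ 2) Filter.atTop (nhds 0) →
    ∀ (N : ℕ → ℕ) (ψ : ∀ L, Literature.MathematicalPhysics.QuantumLattice.Fock
    (Literature.MathematicalPhysics.QuantumLattice.Orb
    (Literature.MathematicalPhysics.QuantumLattice.FermionTorus 2 L))), (∀ L, Even L → N L = 2 * ⌊(1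
    - δ) * (L : ℝ) ^ 2 / 2⌋₊ ∧ star (ψ L) ⬝ᵥ ψ L = 1 ∧
    Literature.MathematicalPhysics.QuantumLattice.IsGroundStateInSector
    (Literature.MathematicalPhysics.QuantumLattice.hubbardTorus 2 L 1 U) (N L) 0 (ψ L)) →
    (∃ c : ℝ, 0 < c ∧ ∃ᶠ k : ℕ in Filter.atTop, c ≤ (∑ x ∈
    Literature.Probability.LatticeModels.halfOpenBox 2 (2 * k), ∑ y ∈
    Literature.Probability.LatticeModels.halfOpenBox 2 (2 * k),
    Literature.MathematicalPhysics.QuantumLattice.torusPullback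
    (Literature.MathematicalPhysics.QuantumLattice.pairFieldCorr
    Literature.MathematicalPhysics.QuantumLattice.dWaveFormFactor ψ) (2 * k) x y) /
    ((Literature.Probability.LatticeModels.halfOpenBox 2 (2 * k)).card : ℝ) ^ 2) →
    Literature.MathematicalPhysics.QuantumLattice.HasDWaveOrder U μ := by
  intro U δ μ hU _hδ hTL hEM N ψ hψ hord
  obtain ⟨c, hc, hfreq⟩ := hord
  obtain ⟨B, _hB, hkink⟩ := exists_kinkBound
  set ε : ℝ := Real.sqrt c / 2 with hε_def
  have hε : 0 < ε := half_pos (Real.sqrt_pos.2 hc)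
  set K : ℝ := 1 + U + |μ| with hK_def
  -- the energy-matching defect density `x_L → 0`
  set x : ℕ → ℝ := fun L =>
    ((hubbardTorus 2 (L + 1) 1 U).minEnergyOn
          (szSector (2 * ⌊(1 - δ) * ((L + 1 : ℕ) : ℝ) ^ 2 / 2⌋₊) 0) -
        μ * ((2 * ⌊(1 - δ) * ((L + 1 : ℕ) : ℝ) ^ 2 / 2⌋₊ : ℕ) : ℝ) -
        (hubbardTorusWith 2 (L + 1) 1 U μ).groundEnergy) / ((L + 1 : ℕ) : ℝ) ^ 2 with hx_def
  have hx : Tendsto x atTop (𝓝 0) := hEM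
  rw [hasDWaveOrder_iff]
  refine lt_of_lt_of_le hε ?_
  refine le_dWaveOrderParameter_of_le_liminf_energyGain U μ zero_lt_one fun h hh => ?_
  -- (TL): the gain sequence converges, so its liminf is its limit
  obtain ⟨e₀, he₀⟩ := hTL 0 le_rfl
  obtain ⟨e₁, he₁⟩ := hTL h hh.1.le
  have hg : Tendsto (fun L : ℕ => ((dWaveSourceTorus (L + 1) U μ 0).groundEnergy -
      (dWaveSourceTorus (L + 1) U μ h).groundEnergy) / (2 * h * (((L + 1 : ℕ) : ℝ)) ^ 2)) atTop
      (𝓝 ((e₀ - e₁) / (2 * h))) := by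
    refine ((he₀.sub he₁).div_const (2 * h)).congr' (Eventually.of_forall fun L => ?_)
    have hL : (((L + 1 : ℕ) : ℝ)) ^ 2 ≠ 0 := by positivity
    have hh0 : h ≠ 0 := hh.1.ne'
    field_simp
  -- (ORDER) + the kink bound: frequently `ε - r_L ≤ g_L`
  have hfg : ∃ᶠ L : ℕ in atTop,
      ε - x L / (4 * h) - B * K / (4 * h * ε) * Real.sqrt (x L) -
          B * K / (8 * h * ε ^ 2) / (((L + 1 : ℕ) : ℝ)) ^ 4 ≤
        ((dWaveSourceTorus (L + 1) U μ 0).groundEnergy -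
          (dWaveSourceTorus (L + 1) U μ h).groundEnergy) / (2 * h * (((L + 1 : ℕ) : ℝ)) ^ 2) := by
    refine Filter.frequently_atTop.2 fun a => ?_
    obtain ⟨k, hka, hk⟩ := Filter.frequently_atTop.1 hfreq (a + 1)
    obtain ⟨j, rfl⟩ : ∃ j, k = j + 1 := ⟨k - 1, by omega⟩
    refine ⟨2 * j + 1, by omega, ?_⟩
    have h2 : 2 * (j + 1) = 2 * j + 1 + 1 := by ring
    rw [h2, sum_torusPullback_succ, sum_pairFieldCorr_succ] at hk
    obtain ⟨hNL, hnorm, hgs⟩ := hψ (2 * j + 1 + 1) ⟨j + 1, by ring⟩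
    rw [hNL] at hgs
    have hM : (0 : ℝ) < (((2 * j + 1 + 1 : ℕ) : ℝ)) ^ (2 * 2) := by positivity
    rw [le_div_iff₀ hM, show (((2 * j + 1 + 1 : ℕ) : ℝ)) ^ (2 * 2) =
      (((2 * j + 1 + 1 : ℕ) : ℝ)) ^ 4 by norm_num] at hk
    exact hkink (2 * j + 1 + 1) U μ h c hU.le hh.1 hc _ _ hnorm hgs hk
  have hlim := wcbcs_remainder_tendsto hx ε h (B * K / (4 * h * ε)) (B * K / (8 * h * ε ^ 2))
  rw [hg.liminf_eq]
  exact le_of_tendsto_of_tendsto_of_frequently hlim hg hfg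

end Summit.HubbardSuperconductivity.HubbardSuperconductivity.Theorems.NodalDiracTwist.BridgeNodalToDWave
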